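import Mathlib
import HarnessLib
import Summits.NavierStokesRegularity.NavierStokesRegularity.Theorems.LocalSineTubeDoorProfileAlignedWindowRigidityAncient

/-!
# The door family's GENERIC WINDOW GLUE (Fatou on one similarity window, first-order scalars)

Cell ns-regularity-ideate, seat p6 (route-directed support for nsreg-p1's one-window door family LocalSineTubeDoor →
PoloidalWindowDoor → LocalVelCompTubeDoor (S10) → LocalTubeDoorHelicity (S11) → …; anchor
`--supports stmt-NavierStokesRegularity-20017`).  Every door of the family has the shape «local Type I at `(x₀,T)` + the
scale-normalised scalar `F(√(T−t) u, (T−t) ∇u)` read at the similarity point `x₀ + √(T−t) y` fades in `L¹` over ONE open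
window `U` ⇒ regular», and every certified `closes` so far (LocalSineTubeDoor, S10, S11's `localTubeDoorHelicity_of`)
re-ran the same Fatou-on-the-window argument for its particular `F`.  This file proves that argument ONCE, for an
arbitrary continuous first-order scalar `F : ℝ³ → (ℝ³ →L ℝ³) → ℝ`, against the conclusion shape of the universal zoom
crux `…LocalSineTubeDoorLocalPointZoomGradSlices.localPointZoomVelGradSlices` (velocities AND gradients converge
pointwise on every slice along one sequence `λⱼ`):

* `windowFatou_firstOrder` — along the zoom times `tⱼ = T + λⱼ²s/ν → T⁻` the window velocity is `σν ×` the rescaled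
  velocity at `σy` and the window gradient `(T−tⱼ) ∇u` is `σ²ν ×` the rescaled gradient at `σy` (`σ = √(−s)/√ν`), so the
  window scalar converges pointwise to `F(σν v(s,σy), σ²ν Dv(s)(σy))`; Fatou (`lintegral_liminf_le'`) and the fading
  hypothesis make it vanish a.e. on `U`, hence everywhere on `U` by continuity (slices of the profile class are real-analytic,
  so `y ↦ Dv(s)(y)` is continuous): **for every `s < 0` and `y ∈ U`, `F(σν • v(s, σy), σ²ν • Dv(s)(σy)) = 0`**;
* `windowFatou_firstOrder_of_zeroSetInvariant` — if the zero set of `F` is invariant under positive rescalings of its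
  two arguments (true for every door so far: `|sin∠|`, `⟪·,e⟫²`, `|⟪a, curl A⟫|`, …), the conclusion is the clean window
  statement in profile coordinates: `F(v(s,z), Dv(s)(z)) = 0` for all `z ∈ σ • U` — an open nonempty window, which is
  exactly the hypothesis shape of the family's profile cruxes (K2, K2′, K2⁗, …).

With `localPointZoomVelGradSlices` + this file, a new door of the family costs only its profile crux: the zoom crux
and the glue are by name.

WHAT THIS IS NOT: not a claim about Navier–Stokes regularity; measure-theoretic glue for door routes (bears_on
LADDER-NS N0).
-/

noncomputable section

-- the summit and its single sub-problem share the name (CONVENTIONS §1), as in every Theorems file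
set_option linter.dupNamespace false

namespace Summit.NavierStokesRegularity.NavierStokesRegularity.Theorems.LocalSineTubeDoorWindowFatou

open MeasureTheory Set Function Filter Topology TopologicalSpace Metric
open scoped RealInnerProductSpace InnerProductSpace NNReal ENNReal
open Literature.Analysis Literature.Analysis.FluidPDE
open Summit.NavierStokesRegularity.NavierStokesRegularity.Theorems.LocalSineTubeDoorProfileAlignedWindowRigidityAncient

/-- **GENERIC WINDOW GLUE (Fatou on one similarity window, first-order scalars).**  Let `u` be a classical solution on
`[0,T)`, `(v, λⱼ)` zoom data at `x₀` in the sense of `localPointZoomVelGradSlices` (a profile of the Type-I class — rate,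
continuity on the open slab, unit-viscosity Oseen–Duhamel identity — attracting the rescaled velocities AND gradients
pointwise on every slice), `F` a continuous scalar function of a vector and a linear map, and `U` an open window on
which the normalised window scalar `F(√(T−t) u(t, x₀ + √(T−t)y), √(T−t)² Du(t)(x₀ + √(T−t)y))` fades in `L¹` as
`t → T⁻`.  Then for every `s < 0` and every `y ∈ U`, with `σ = √(−s)/√ν`:
`F(σν • v(s, σy), σ²ν • Dv(s)(σy)) = 0`. -/
theorem windowFatou_firstOrder {ν T : ℝ} (hν : 0 < ν) (hT : 0 < T)
    {u : ℝ → EuclideanSpace ℝ (Fin 3) → EuclideanSpace ℝ (Fin 3)} {p : ℝ → EuclideanSpace ℝ (Fin 3) → ℝ}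
    (hcl : IsClassicalNSSolutionOn (Ico 0 T) ν 0 u p) {x₀ : EuclideanSpace ℝ (Fin 3)}
    {C : ℝ} {v : ℝ → EuclideanSpace ℝ (Fin 3) → EuclideanSpace ℝ (Fin 3)} {lam : ℕ → ℝ}
    (hlam : ∀ j, 0 < lam j) (hlam0 : Tendsto lam atTop (𝓝 0))
    (hrate : HasTypeITimeDecay C v) (hcont : ContinuousOn (uncurry v) (Iio (0 : ℝ) ×ˢ univ))
    (hmild : ∀ s t : ℝ, s < t → t < 0 → ∀ x,
      v t x = UnboundedOperators.heatExtension (v s) (t - s) x - oseenDuhamel 1 s v v t x)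
    (hconv : ∀ s < 0, ∀ y,
      Tendsto (fun j => (lam j / ν) • u (T + lam j ^ 2 * s / ν) (x₀ + lam j • y)) atTop (𝓝 (v s y)) ∧
      Tendsto (fun j => (lam j ^ 2 / ν) • fderiv ℝ (u (T + lam j ^ 2 * s / ν)) (x₀ + lam j • y)) atTop
        (𝓝 (fderiv ℝ (v s) y)))
    (F : EuclideanSpace ℝ (Fin 3) → (EuclideanSpace ℝ (Fin 3) →L[ℝ] EuclideanSpace ℝ (Fin 3)) → ℝ)
    (hF : Continuous fun q : EuclideanSpace ℝ (Fin 3) × (EuclideanSpace ℝ (Fin 3) →L[ℝ] EuclideanSpace ℝ (Fin 3)) =>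
      F q.1 q.2)
    {U : Set (EuclideanSpace ℝ (Fin 3))} (hU : IsOpen U)
    (hfade : Tendsto (fun t => ∫⁻ y in U, ENNReal.ofReal
      |F (Real.sqrt (T - t) • u t (x₀ + Real.sqrt (T - t) • y))
        (Real.sqrt (T - t) ^ 2 • fderiv ℝ (u t) (x₀ + Real.sqrt (T - t) • y))|) (𝓝[<] T) (𝓝 0))
    {s : ℝ} (hs : s < 0) {y : EuclideanSpace ℝ (Fin 3)} (hy : y ∈ U) :
    F ((Real.sqrt (-s) / Real.sqrt ν * ν) • v s ((Real.sqrt (-s) / Real.sqrt ν) • y))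
      (((Real.sqrt (-s) / Real.sqrt ν) ^ 2 * ν) • fderiv ℝ (v s) ((Real.sqrt (-s) / Real.sqrt ν) • y)) = 0 := by
  -- ## zoom times `tⱼ = T + λⱼ² s/ν → T⁻`
  have hns : 0 < -s := neg_pos.2 hs
  obtain ⟨t, ht⟩ : ∃ t : ℕ → ℝ, ∀ j, t j = T + lam j ^ 2 * s / ν := ⟨_, fun j => rfl⟩
  have hTt : ∀ j, T - t j = lam j ^ 2 * (-s) / ν := fun j => by rw [ht j]; ring
  have hc : ∀ j, 0 < lam j ^ 2 * (-s) / ν := fun j => div_pos (mul_pos (pow_pos (hlam j) 2) hns) hν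
  have hc0 : Tendsto (fun j => lam j ^ 2 * (-s) / ν) atTop (𝓝 0) := by
    simpa using ((hlam0.pow 2).mul_const (-s)).div_const ν
  have htT : Tendsto t atTop (𝓝[<] T) := by
    refine tendsto_nhdsWithin_iff.2 ⟨?_, Eventually.of_forall fun j => ?_⟩
    · have h1 : Tendsto (fun j => T - lam j ^ 2 * (-s) / ν) atTop (𝓝 (T - 0)) :=
        tendsto_const_nhds.sub hc0
      rw [sub_zero] at h1
      refine h1.congr fun j => ?_
      rw [ht j]; ring
    · show t j < T
      have h1 := hc j
      rw [← hTt j] at h1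
      linarith
  have hev : ∀ᶠ j in atTop, t j ∈ Set.Ioo 0 T := htT.eventually (Ioo_mem_nhdsLT hT)
  obtain ⟨j₀, hj₀⟩ := eventually_atTop.1 hev
  have hshift : Tendsto (fun j : ℕ => j + j₀) atTop atTop := tendsto_add_atTop_nat j₀
  have hfadej : Tendsto (fun j => ∫⁻ y in U, ENNReal.ofReal
      |F (Real.sqrt (T - t (j + j₀)) • u (t (j + j₀)) (x₀ + Real.sqrt (T - t (j + j₀)) • y))
        (Real.sqrt (T - t (j + j₀)) ^ 2 • fderiv ℝ (u (t (j + j₀))) (x₀ + Real.sqrt (T - t (j + j₀)) • y))|)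
      atTop (𝓝 0) := (hfade.comp htT).comp hshift
  -- ## the similarity scale along the zoom: `√(T − tⱼ) = λⱼ σ`, `σ = √(−s)/√ν`
  set σ : ℝ := Real.sqrt (-s) / Real.sqrt ν with hσ
  have hσpos : 0 < σ := div_pos (Real.sqrt_pos.2 hns) (Real.sqrt_pos.2 hν)
  have hsq : ∀ j, Real.sqrt (T - t j) = lam j * σ := by
    intro j
    rw [hTt j, hσ, Real.sqrt_div' _ hν.le, Real.sqrt_mul (pow_nonneg (hlam j).le 2),
      Real.sqrt_sq (hlam j).le]
    ring
  -- window velocity / window gradient at time `tⱼ` versus the rescaled ones at `σ y`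
  set W : ℕ → EuclideanSpace ℝ (Fin 3) → EuclideanSpace ℝ (Fin 3) := fun j y =>
    Real.sqrt (T - t (j + j₀)) • u (t (j + j₀)) (x₀ + Real.sqrt (T - t (j + j₀)) • y) with hWdef
  have hW : ∀ (j : ℕ) (y : EuclideanSpace ℝ (Fin 3)), W j y =
      (σ * ν) • ((lam (j + j₀) / ν) • u (T + lam (j + j₀) ^ 2 * s / ν)
        (x₀ + lam (j + j₀) • (σ • y))) := by
    intro j y
    simp only [hWdef, hsq (j + j₀), smul_smul]
    rw [ht (j + j₀)]
    congr 1
    field_simp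
  set G : ℕ → EuclideanSpace ℝ (Fin 3) → (EuclideanSpace ℝ (Fin 3) →L[ℝ] EuclideanSpace ℝ (Fin 3)) := fun j y =>
    Real.sqrt (T - t (j + j₀)) ^ 2 • fderiv ℝ (u (t (j + j₀))) (x₀ + Real.sqrt (T - t (j + j₀)) • y) with hGdef
  have hG : ∀ (j : ℕ) (y : EuclideanSpace ℝ (Fin 3)), G j y =
      (σ ^ 2 * ν) • ((lam (j + j₀) ^ 2 / ν) • fderiv ℝ (u (T + lam (j + j₀) ^ 2 * s / ν))
        (x₀ + lam (j + j₀) • (σ • y))) := by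
    intro j y
    simp only [hGdef, hsq (j + j₀), smul_smul]
    rw [ht (j + j₀)]
    congr 1
    field_simp
  -- ## the limit scalar in window coordinates and its continuity
  set Hs : EuclideanSpace ℝ (Fin 3) → ℝ := fun y =>
    F ((σ * ν) • v s (σ • y)) ((σ ^ 2 * ν) • fderiv ℝ (v s) (σ • y)) with hHsdef
  have han : AnalyticOnNhd ℝ (v s) univ := analyticOnNhd_slice hcont (bdd_of_hasTypeITimeDecay hrate) hmild hs
  have hvs : Continuous (v s) := by
    rw [← continuousOn_univ]; exact han.continuousOn
  have hDvs : Continuous (fderiv ℝ (v s)) := (han.contDiff (n := 1)).continuous_fderiv one_ne_zero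
  have hHscont : Continuous Hs := by
    show Continuous fun y => F ((σ * ν) • v s (σ • y)) ((σ ^ 2 * ν) • fderiv ℝ (v s) (σ • y))
    exact hF.comp ((((hvs.comp (continuous_const_smul σ)).const_smul (σ * ν)).prodMk
      ((hDvs.comp (continuous_const_smul σ)).const_smul (σ ^ 2 * ν))))
  have hconvW : ∀ y, Tendsto (fun j => W j y) atTop (𝓝 ((σ * ν) • v s (σ • y))) := by
    intro y
    have h := (((hconv s hs (σ • y)).1).comp hshift).const_smul (σ * ν)
    exact h.congr fun j => (hW j y).symm
  have hconvG : ∀ y, Tendsto (fun j => G j y) atTop (𝓝 ((σ ^ 2 * ν) • fderiv ℝ (v s) (σ • y))) := by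
    intro y
    have h := (((hconv s hs (σ • y)).2).comp hshift).const_smul (σ ^ 2 * ν)
    exact h.congr fun j => (hG j y).symm
  have hconvH : ∀ y, Tendsto (fun j => F (W j y) (G j y)) atTop (𝓝 (Hs y)) := fun y =>
    (hF.tendsto _).comp ((hconvW y).prodMk_nhds (hconvG y))
  -- measurability of the window scalars: `u(tⱼ)` is smooth for the shifted times
  have hmem : ∀ j, t (j + j₀) ∈ Set.Ico 0 T := fun j =>
    ⟨(hj₀ (j + j₀) (Nat.le_add_left _ _)).1.le, (hj₀ (j + j₀) (Nat.le_add_left _ _)).2⟩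
  have hφ : ∀ j, Continuous fun y : EuclideanSpace ℝ (Fin 3) => x₀ + Real.sqrt (T - t (j + j₀)) • y :=
    fun j => continuous_const.add (continuous_const_smul _)
  have hWc : ∀ j, Continuous (W j) := fun j => by
    show Continuous fun y => Real.sqrt (T - t (j + j₀)) • u (t (j + j₀)) (x₀ + Real.sqrt (T - t (j + j₀)) • y)
    exact ((hcl.contDiff_velocity (hmem j)).continuous.comp (hφ j)).const_smul (Real.sqrt (T - t (j + j₀)))
  have hGc : ∀ j, Continuous (G j) := fun j => by
    show Continuous fun y =>
      Real.sqrt (T - t (j + j₀)) ^ 2 • fderiv ℝ (u (t (j + j₀))) (x₀ + Real.sqrt (T - t (j + j₀)) • y)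
    exact (((hcl.contDiff_velocity (hmem j)).continuous_fderiv (by norm_cast)).comp (hφ j)).const_smul
      (Real.sqrt (T - t (j + j₀)) ^ 2)
  have hFjc : ∀ j, Continuous fun y => F (W j y) (G j y) := fun j => hF.comp ((hWc j).prodMk (hGc j))
  -- ## FATOU: the faded scalar vanishes on the window in the limit
  set g : EuclideanSpace ℝ (Fin 3) → ℝ≥0∞ := fun y => ENNReal.ofReal |Hs y| with hg
  have hgc : Continuous g := ENNReal.continuous_ofReal.comp (continuous_abs.comp hHscont)
  have hgjm : ∀ j, Measurable fun y => ENNReal.ofReal |F (W j y) (G j y)| :=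
    fun j => (ENNReal.continuous_ofReal.comp (continuous_abs.comp (hFjc j))).measurable
  have hptw : ∀ y, Tendsto (fun j => ENNReal.ofReal |F (W j y) (G j y)|) atTop (𝓝 (g y)) :=
    fun y => ENNReal.tendsto_ofReal ((continuous_abs.tendsto (Hs y)).comp (hconvH y))
  have hFatou : ∫⁻ y in U, liminf (fun j => ENNReal.ofReal |F (W j y) (G j y)|) atTop ≤
      liminf (fun j => ∫⁻ y in U, ENNReal.ofReal |F (W j y) (G j y)|) atTop :=
    lintegral_liminf_le' (fun j => (hgjm j).aemeasurable)
  have hlim : (fun y => liminf (fun j => ENNReal.ofReal |F (W j y) (G j y)|) atTop) = g :=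
    funext fun y => (hptw y).liminf_eq
  have hfadeW : Tendsto (fun j => ∫⁻ y in U, ENNReal.ofReal |F (W j y) (G j y)|) atTop (𝓝 0) := hfadej
  rw [hlim, hfadeW.liminf_eq] at hFatou
  have hint : ∫⁻ y in U, g y = 0 := le_antisymm hFatou bot_le
  have hae : ∀ᵐ y ∂(volume.restrict U), g y = 0 := (lintegral_eq_zero_iff hgc.measurable).1 hint
  rw [ae_restrict_iff' hU.measurableSet] at hae
  have hzero : ∀ y ∈ U, g y = 0 := by
    intro y hy
    by_contra hne
    set O : Set (EuclideanSpace ℝ (Fin 3)) := U ∩ g ⁻¹' (Ioi 0) with hO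
    have hOo : IsOpen O := hU.inter (isOpen_Ioi.preimage hgc)
    have hO0 : volume O = 0 := by
      rw [measure_eq_zero_iff_ae_notMem]
      filter_upwards [hae] with y' hy'
      rintro ⟨h1, h2⟩
      have := hy' h1
      simp only [mem_preimage, mem_Ioi, this, lt_self_iff_false] at h2
    have hOe : O = ∅ := (hOo.measure_eq_zero_iff volume).1 hO0
    have hyO : y ∈ O := ⟨hy, by simpa [mem_preimage, mem_Ioi, pos_iff_ne_zero] using hne⟩
    rw [hOe] at hyO
    exact hyO
  have h := hzero y hy
  simp only [hg, ENNReal.ofReal_eq_zero] at h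
  exact abs_eq_zero.1 (le_antisymm h (abs_nonneg _))

/-- **Generic window glue, profile-coordinate form.**  If moreover the zero set of `F` is invariant under positive
rescalings of its arguments (`F (a•x) (b•A) = 0 ↔ F x A = 0` for `a, b > 0` — the case of every door so far), then for
every `s < 0` the profile scalar `F(v(s,z), Dv(s)(z))` vanishes at every `z` of the open window `σ • U`
(`σ = √(−s)/√ν`), i.e. whenever `σ⁻¹ • z ∈ U` — the window hypothesis shape of the family's profile cruxes. -/
theorem windowFatou_firstOrder_of_zeroSetInvariant {ν T : ℝ} (hν : 0 < ν) (hT : 0 < T)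
    {u : ℝ → EuclideanSpace ℝ (Fin 3) → EuclideanSpace ℝ (Fin 3)} {p : ℝ → EuclideanSpace ℝ (Fin 3) → ℝ}
    (hcl : IsClassicalNSSolutionOn (Ico 0 T) ν 0 u p) {x₀ : EuclideanSpace ℝ (Fin 3)}
    {C : ℝ} {v : ℝ → EuclideanSpace ℝ (Fin 3) → EuclideanSpace ℝ (Fin 3)} {lam : ℕ → ℝ}
    (hlam : ∀ j, 0 < lam j) (hlam0 : Tendsto lam atTop (𝓝 0))
    (hrate : HasTypeITimeDecay C v) (hcont : ContinuousOn (uncurry v) (Iio (0 : ℝ) ×ˢ univ))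
    (hmild : ∀ s t : ℝ, s < t → t < 0 → ∀ x,
      v t x = UnboundedOperators.heatExtension (v s) (t - s) x - oseenDuhamel 1 s v v t x)
    (hconv : ∀ s < 0, ∀ y,
      Tendsto (fun j => (lam j / ν) • u (T + lam j ^ 2 * s / ν) (x₀ + lam j • y)) atTop (𝓝 (v s y)) ∧
      Tendsto (fun j => (lam j ^ 2 / ν) • fderiv ℝ (u (T + lam j ^ 2 * s / ν)) (x₀ + lam j • y)) atTop
        (𝓝 (fderiv ℝ (v s) y)))
    (F : EuclideanSpace ℝ (Fin 3) → (EuclideanSpace ℝ (Fin 3) →L[ℝ] EuclideanSpace ℝ (Fin 3)) → ℝ)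
    (hF : Continuous fun q : EuclideanSpace ℝ (Fin 3) × (EuclideanSpace ℝ (Fin 3) →L[ℝ] EuclideanSpace ℝ (Fin 3)) =>
      F q.1 q.2)
    (hzero : ∀ (a b : ℝ), 0 < a → 0 < b → ∀ (x : EuclideanSpace ℝ (Fin 3))
      (A : EuclideanSpace ℝ (Fin 3) →L[ℝ] EuclideanSpace ℝ (Fin 3)), F (a • x) (b • A) = 0 ↔ F x A = 0)
    {U : Set (EuclideanSpace ℝ (Fin 3))} (hU : IsOpen U)
    (hfade : Tendsto (fun t => ∫⁻ y in U, ENNReal.ofReal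
      |F (Real.sqrt (T - t) • u t (x₀ + Real.sqrt (T - t) • y))
        (Real.sqrt (T - t) ^ 2 • fderiv ℝ (u t) (x₀ + Real.sqrt (T - t) • y))|) (𝓝[<] T) (𝓝 0))
    {s : ℝ} (hs : s < 0) {z : EuclideanSpace ℝ (Fin 3)} (hz : (Real.sqrt (-s) / Real.sqrt ν)⁻¹ • z ∈ U) :
    F (v s z) (fderiv ℝ (v s) z) = 0 := by
  have hns : 0 < -s := neg_pos.2 hs
  have hσpos : 0 < Real.sqrt (-s) / Real.sqrt ν := div_pos (Real.sqrt_pos.2 hns) (Real.sqrt_pos.2 hν)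
  have h := windowFatou_firstOrder hν hT hcl hlam hlam0 hrate hcont hmild hconv F hF hU hfade hs hz
  rw [smul_smul, mul_inv_cancel₀ hσpos.ne', one_smul] at h
  exact (hzero _ _ (mul_pos hσpos hν) (mul_pos (pow_pos hσpos 2) hν) _ _).1 h

end Summit.NavierStokesRegularity.NavierStokesRegularity.Theorems.LocalSineTubeDoorWindowFatou

end
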